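import Summits.CriticalPhenomena.PercolationContinuityZ3.Theorems.Transplant.KNCells2SepQ
import Summits.CriticalPhenomena.PercolationContinuityZ3.Theorems.Transplant.KNCells2CorridorSub
import Summits.CriticalPhenomena.PercolationContinuityZ3.Theorems.Transplant.KNCells2FaceSub
import Summits.CriticalPhenomena.PercolationContinuityZ3.Theorems.Transplant.KNCells2RootSub
import Summits.CriticalPhenomena.PercolationContinuityZ3.Theorems.Transplant.BoxProdZ2TubeLevels
import HarnessLib

/-!
# Design (D): the three SUBBOX obligations IN THE TUBE GRAPH over `X □ ℤ²` reduced to their instance content — the `hsub` hypotheses of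
# `hreach_of_tubeChain` (law `Wcor`), `cond_of_tubeStep` (law `Wt`) and `RootOblT` / `RootOblA` (law `W0sub`) for any lag-1 anchored scheme
# `S : KSchA (W × Site 2) A`, composed from the generic graph-subbox lemmas (`isSubbox_Wcor_graph` p217063, `isSubbox_Wt_graph` p217253,
# `isSubbox_W0sub_graph` p221247) and the separation layer (`QSepGeom`, `disjoint_Vx_of_fresh`, `mem_of_adj_fresh`, p221141)

builds on p205010 (kernel theorem, internal audit signed; external expert review pending) — nothing in this file uses p205010.
Lane `prim-bschramm`, seat `prim-bschramm-p2` (residue `hout_of_valid`, lead 14:35:13Z); helper file (`--supports stmt-CriticalPhenomena-4575`).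

After the generic reductions the instance (p3-g2, `cellGeomCG`) only owes, per region `Dd` of a step: the fibres of `Dd` lie in the window `π`;
`Dd` lies in the habitat `Q_b(x) ∪ E^far_{a'}(x, du)` (some anchor `b`), in `Sx` / `Ucor`; and the TUBE-ADJACENCY of the lineage's own sets
(`E_{v,x} ∪ H_{x,y}` for the corridor, `E_{v,x} ∪ E^far` for the face step) towards `Dd` — p2's `tube_adj_of_mem_Ewv_Hfull` /
`tube_adj_of_mem_Ewv_Efar` (KNCellsBoxProdZ2ConcHout, p221432) from the schedule radii; for the root world cut to the tube nothing at all.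
* **`isSubbox_Wcor_tube`** (corridor law), **`isSubbox_Wt_tube`** (face law; plus the planar disjointness of `Dd` from `E_{v,x} ∪ Stub_j`),
  **`isSubbox_W0sub_tube`** (root law cut to `U' := U.filter (·.1 ∈ π)`: only `Dd ⊆ U'` and `Dd ∩ Q_0 = ∅`).
[cite: KozmaNitzan2024, §4 p. 17 (subbox), p. 26 ((29)), p. 28, p. 30, p. 31] [cite: GrimmettPercolation1999, §7.2]
-/

noncomputable section

open MeasureTheory ProbabilityTheory
open scoped ENNReal Classical

namespace Summit.CriticalPhenomena.PercolationContinuityZ3.Theorems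

namespace Transplant

namespace KNCells

open Literature.Probability.Percolation Literature.Probability.LatticeModels SimpleGraph GadgetSystem ProbeHistory HSiteScheme Contour
open BoxProdZ2

namespace KSchA

variable {W : Type} [DecidableEq W] (X : SimpleGraph W) [X.LocallyFinite]
variable {A : Type*} {S : KSchA (W × Site 2) A} {FD : FaceData (W × Site 2) A} {LD : LevelData (W × Site 2) A}
variable {h : ProbeHistory (W × Site 2)} {e : Site 2 × MDir} {a a' b : A} {du : MDir}

/-- **The corridor law `Wcor` is a subbox weighting of the tube graph on a fresh region `Dd`** with fibres in the window `π`, inside the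
habitat `Q_b(x) ∪ E^far_{a'}(x,du)`, `Sx` and `Ucor`, provided every vertex of `E_{v,x} ∪ H_{x,y}` adjacent to `Dd` is tube-adjacent (the
explored region cannot touch `Dd`: `QSepGeom` + validity). [cite: KozmaNitzan2024, §4 p. 17 (subbox), p. 31] -/
theorem isSubbox_Wcor_tube (π : Finset W) (hL : LevelGeom (X □ zdGraph 2) S.Γ FD LD) (hQ : QSepGeom (X □ zdGraph 2) S.Γ)
    (hV : S.Valid₂ (X □ zdGraph 2) h e) (hdu : du ∈ S.onward (X □ zdGraph 2) h (tgt e)) {Dd : Finset (W × Site 2)}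
    (hDh : Dd ⊆ S.Γ.Q b (tgt e) ∪ S.Γ.Efar a' (tgt e) du)
    (hD : Dd ⊆ S.Sx (X □ zdGraph 2) h e a a' du) (hDU : Dd ⊆ S.Ucor (X □ zdGraph 2) FD h e a a' du) (hπ : ∀ u ∈ Dd, u.1 ∈ π)
    (hout : ∀ v ∈ Dd, ∀ x ∈ S.Γ.Ewv a e.1 e.2 ∪ FD.Hfull a' (tgt e) du, (X □ zdGraph 2).Adj x v → (tubeGraph X π).Adj x v) :
    KNLevels.IsSubbox (tubeGraph X π) (S.Wcor (X □ zdGraph 2) FD h e a a' du) S.p Dd :=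
  isSubbox_Wcor_graph (tubeGraph X π) (tubeGraph_le X π) hV.F_eq hD hDU (disjoint_Vx_of_fresh hL hQ hV hdu hDh)
    (fun u hu v hv hadj => (tubeGraph_adj X).2 ⟨hadj, hπ u hu, hπ v hv⟩)
    (fun v hv x hx _ hadj => hout v hv x (mem_of_adj_fresh hL hQ hV hdu hDh hv hx hadj) hadj)

/-- **The face law `Wt` is a subbox weighting of the tube graph on a fresh region `Dd`** with fibres in `π`, inside the habitat
`Q_b(x) ∪ E^far_{a'}(x,du)` and `Sx`, disjoint from `E_{v,x} ∪ Stub_j`, provided every vertex of `E_{v,x} ∪ E^far` adjacent to `Dd` is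
tube-adjacent. [cite: KozmaNitzan2024, §4 p. 17 (subbox), p. 30 (Step III)] -/
theorem isSubbox_Wt_tube (π : Finset W) (hL : LevelGeom (X □ zdGraph 2) S.Γ FD LD) (hQ : QSepGeom (X □ zdGraph 2) S.Γ)
    (hV : S.Valid₂ (X □ zdGraph 2) h e) (hdu : du ∈ S.onward (X □ zdGraph 2) h (tgt e)) {j : ℕ} {o : Finset (Sym2 (W × Site 2))}
    {Dd : Finset (W × Site 2)} (hDh : Dd ⊆ S.Γ.Q b (tgt e) ∪ S.Γ.Efar a' (tgt e) du) (hD : Dd ⊆ S.Sx (X □ zdGraph 2) h e a a' du)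
    (hdis : Disjoint Dd (S.Γ.Ewv a e.1 e.2 ∪ S.Γ.Stub a' (tgt e) du j)) (hπ : ∀ u ∈ Dd, u.1 ∈ π)
    (hout : ∀ v ∈ Dd, ∀ x ∈ S.Γ.Ewv a e.1 e.2 ∪ S.Γ.Efar a' (tgt e) du, (X □ zdGraph 2).Adj x v → (tubeGraph X π).Adj x v) :
    KNLevels.IsSubbox (tubeGraph X π) (S.Wt (X □ zdGraph 2) h e a a' du j o) S.p Dd :=
  isSubbox_Wt_graph (tubeGraph X π) (tubeGraph_le X π) hD
    (Finset.disjoint_union_right.2 ⟨Finset.disjoint_union_right.2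
      ⟨disjoint_Vx_of_fresh hL hQ hV hdu hDh, (Finset.disjoint_union_right.1 hdis).1⟩, (Finset.disjoint_union_right.1 hdis).2⟩)
    (fun u hu v hv hadj => (tubeGraph_adj X).2 ⟨hadj, hπ u hu, hπ v hv⟩)
    (fun v hv x hx _ hadj => hout v hv x (mem_Sx_of_adj_fresh hL hQ hV hdu hDh hv hx hadj) hadj)

/-- **The root law cut to the tube, `W0sub (U.filter (·.1 ∈ π))`, is a subbox weighting of the tube graph on every `Dd` inside the cut
world and off the root cube `Q_0`** (no separation input: every vertex of the cut world has its fibre in `π`).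
[cite: KozmaNitzan2024, §4 p. 17 (subbox), p. 28 ((32) at the root)] -/
theorem isSubbox_W0sub_tube (π : Finset W) {U Dd : Finset (W × Site 2)} (hDU : Dd ⊆ U.filter fun y => y.1 ∈ π)
    (hdis : Disjoint Dd (S.Γ.Q S.Γ.a₀ 0)) :
    KNLevels.IsSubbox (tubeGraph X π) (S.W0sub (X □ zdGraph 2) (U.filter fun y => y.1 ∈ π)) S.p Dd :=
  isSubbox_W0sub_graph (tubeGraph X π) (tubeGraph_le X π) hDU hdis
    (fun _ hu _ hv hadj => (tubeGraph_adj X).2 ⟨hadj, (Finset.mem_filter.1 (hDU hu)).2, (Finset.mem_filter.1 (hDU hv)).2⟩)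
    (fun _ hv _ hx _ hadj => (tubeGraph_adj X).2 ⟨hadj, (Finset.mem_filter.1 hx).2, (Finset.mem_filter.1 (hDU hv)).2⟩)

end KSchA

end KNCells

end Transplant

end Summit.CriticalPhenomena.PercolationContinuityZ3.Theorems

end
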